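import Summits.QuantumFields.YangMills.Theorems.BalabanLadderUVSeamRecChessboardPlaquetteExpMoment
import Summits.QuantumFields.YangMills.Theorems.BalabanLadderUVSeamRecCarrierCubePlaquettes
import Summits.QuantumFields.YangMills.Theorems.BalabanLadderUVSeamRecResponseMomentsPinning
import HarnessLib

/-!
# Crux `UVSeamRec` (stmt-QuantumFields-20043), line `coldwall_pure`: the FIXED-SCALE RUNG of the second measure-side binder —
# joint exponential moments (EM_Q) of the classical carriers of separated cubes, `β`- and volume-uniform, extensive, at every fixed `R`

Helper file (`--supports stmt-QuantumFields-20043`) of the LEAD seat `ym-spine-20043-p1` (gen 17).  Registered skeleton RESHAPE 2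
(sha `c86db84aa426ab4c`): stubs {`stub_coldWallSplitFemtoTail`, `stub_gaussianDomination`, `stub_floorsEngine`}.  The second stub,
`GaussianDominationSU2` (= `∃ m₁ v₁ β₁ ℓ₁, EMLin 1 β₁ ℓ₁ m₁ v₁`), is consumed by the line only through (EM_Q) — the doubled joint exponential
moments `⟨exp(2 Σ_{i∈T} Q_i)⟩_{2L+1,β} ≤ exp(B·#T)` of the classical carriers `Q_i = carrierCl C 1 β R (q i) (x i) = βR⁴·classicalResponse_i/C`
of cyclically `2R+4`-separated cubes (`emQ_of_subGaussianLinear` inside `responseMomentsOdd6SU2_of_backgroundField_and_gaussianDomination`), and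
through its first moment (LEAD g16, `dirichletRate_of_coldWallSplit_of_carrierMean`).

WHAT.  For `SU(2)` (fundamental), `β ≥ 2`, every odd torus `(ℤ/(2L+1))⁴`, every `R ≥ 1` with `4R+8 ≤ L`, every cyclically
`2R+4`-separated family of sites `x i` with orientations `q i`, every `T`, and every carrier constant `C ≥ 24R⁴`:

  `⟨exp(2 Σ_{i∈T} carrierCl C 1 β R (q i) (x i))⟩_{2L+1,β} ≤ exp(6(2R+4)⁴ · (81 + 6 log β/(2L+1)) · #T)`

(`torusE_exp_two_mul_sum_carrierCl_le_fixedScale`; the un-doubled form with `C ≥ 12R⁴` is `torusE_exp_sum_carrierCl_le_fixedScale`; on tori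
`2L+1 ≥ log β` the constant is `522(2R+4)⁴`, `…_of_log_le`), and the carrier MEAN `⟨carrierCl 1 1 β R q x⟩_{2L+1,β} ≤ 72R⁴(2R+4)⁴(81 + 6 log β/(2L+1))`
(`torusE_carrierCl_le_fixedScale`).  So (EM_Q) HOLDS AT EVERY FIXED SCALE `R`, uniformly in `β ≥ 2` and in the volume, extensively in `#T`,
with constants `C_R = 24R⁴`, `B_R = 6(2R+4)⁴(81 + 6 log β/(2L+1))` — the open content of `stub_gaussianDomination` is exactly the
`R`-UNIFORMITY of `(C, B)` up to `R·uRec β ≤ ℓ₁` (and the `L < log β` corner).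

HOW (three lines).  (1) CLASSICAL: the torus configuration restricted to a cube is an extension of its own exterior, so the Dirichlet
ground energy is at most the cube's boundary Wilson action, `classicalResponse ≤ m₀(η) ≤ S_cube(U)` (`classicalResponse_le_wilsonBoundaryAction`,
from `classicalResponse_le_tiltedMin_zero` + `tiltedMin_le`), hence `carrierCl C 1 β R ≤ (βR⁴/C)·S_cube` and for `C ≥ 12R⁴` the exponent is
`≤ (β/12)·Σ_i S_{cube i}`.  (2) GEOMETRY: the plaquettes touching the separated cubes project injectively to the torus (base points in
`x i + [−R−2, R+1]⁴`; `torusPlaq_injOn_centred`, `torusPlaq_ne_of_separated`), so `Σ_i S_{cube i}(lift U)` is the cost of ONE set `P` of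
`≤ 6(2R+4)⁴·#T` torus plaquettes (`sum_wilsonBoundaryAction_torusLift_eq`).  (3) MEASURE: the `β`-uniform chessboard exponential moment at
`c = β/12` (`Chessboard.su2_wilsonExpectation_expObs_le`, p640498): `⟨exp((β/12)Σ_{q∈P}φ_q)⟩ ≤ exp(#P(81 + 6 log β/(2L+1)))`.

WHY THE RUNG IS NOT THE STUB (located).  Step (1) replaces the response of the MINIMISER (centre field of the harmonic extension of the
boundary data, `≍ R⁻²β^{-1/2}` by incoherence) by the THERMAL energy of the whole cube (`≍ R⁴/β`): the factor `R⁸` in `C_R·B_R` is coherence × volume,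
invisible to any chessboard/Peierls bound; removing it is the background-field expansion (E0′-type), i.e. the stub itself.

HONEST FRAMING: a fixed-scale, `β`-uniform rung of an OPEN binder; nothing of E0′, NT or the gap; YM mass gap NOT proved; not Clay.

References: Fröhlich–Israel–Lieb–Simon, CMP 62 (1978) Thm. 4.1; Seiler, LNP 159 (1982) Ch. 2, Ch. 4; Georgii (2011) §1.2 (gluing).
-/

open MeasureTheory Finset
open Literature.MathematicalPhysics.QuantumFieldTheory (GaugeConfig LatticeRep wilsonMeasure wilsonExpectation
  isProbabilityMeasure_wilsonMeasure Plaquette)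
open Literature.MathematicalPhysics.QuantumLattice (fundamentalRep fundamentalLatticeRep LGConfig ZdPlaquette plaquettesTouching
  wilsonBoundaryAction torusLift continuous_wilsonBoundaryAction)
open Literature.Probability.LatticeModels (Torus.proj)
open Summit.QuantumFields.YangMills.Cruxes.OSLegsFromFemtoAndGap.DlrCollarTransfer
open Summit.QuantumFields.YangMills.Cruxes.UVSeamRec.BoundaryLawPenetration (wilsonBoundaryAction_nonneg)
open Summit.QuantumFields.YangMills.Cruxes.UVSeamRec.ResponsePinning (torusE_mono integrable_comp_lift torusE_const_mul' torusE_const)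
open Summit.QuantumFields.YangMills.Theorems.SoloBlind (expObs plaquetteCost)
open Summit.QuantumFields.YangMills.Cruxes.UVSeamRec.Chessboard (su2_wilsonExpectation_expObs_le)

noncomputable section

namespace Summit.QuantumFields.YangMills.Cruxes.UVSeamRec.ClassicalResponse

/-! ### §1 The fixed-scale (EM_Q) rung -/

section Rung

/-- **THE FIXED-SCALE RUNG OF `stub_gaussianDomination` (EM_Q form).**  `SU(2)` fundamental, `β ≥ 2`, odd torus `(ℤ/(2L+1))⁴`, `1 ≤ R`,
`4R+8 ≤ L`, a cyclically `2R+4`-separated family `(q i, x i)`, any `T`, any carrier constant `C ≥ 12R⁴`: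
`⟨exp(Σ_{i∈T} carrierCl C 1 β R (q i) (x i))⟩_{2L+1,β} ≤ exp(6(2R+4)⁴ · (81 + 6 log β/(2L+1)) · #T)`.
Classical bound (§1) + one torus plaquette set (§3) + the β-uniform chessboard exponential moment at `c = β/12` (p640498). [folklore] -/
theorem torusE_exp_sum_carrierCl_le_fixedScale {β : ℝ} (hβ : 2 ≤ β) {L n : ℕ} (q : Fin n → Fin 4 × Fin 4)
    (x : Fin n → (Fin 4 → ℤ)) {R : ℕ} (hq : ∀ i, (q i).1 < (q i).2) (hR : 1 ≤ R) (hRL : 4 * R + 8 ≤ L)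
    (hsep : ∀ i j : Fin n, i ≠ j → ∃ k : Fin 4,
      (2 * (R : ℤ) + 4) ≤ |((((x i k - x j k : ℤ) : ZMod (2 * L + 1))).valMinAbs : ℤ)|)
    {C : ℝ} (hC : 12 * (R : ℝ) ^ 4 ≤ C) (T : Finset (Fin n)) :
    torusE (Matrix.specialUnitaryGroup (Fin 2) ℂ) (fundamentalLatticeRep 2) β L
        (fun U => Real.exp (∑ i ∈ T, carrierCl (fundamentalLatticeRep 2) C 1 β R (q i) (x i) U)) ≤
      Real.exp (6 * (2 * R + 4) ^ 4 * (81 + 6 * Real.log β / (2 * L + 1 : ℕ)) * #T) := by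
  classical
  set rF : LatticeRep (Matrix.specialUnitaryGroup (Fin 2) ℂ) := fundamentalLatticeRep 2 with hrF
  have hβ0 : 0 ≤ β := by linarith
  have hR0 : (1 : ℝ) ≤ R := by exact_mod_cast hR
  have hR4 : (1 : ℝ) ≤ (R : ℝ) ^ 4 := one_le_pow₀ hR0
  have hCpos : 0 < C := lt_of_lt_of_le (by positivity) hC
  -- the cube boundary actions
  set S : Fin n → LGConfig 4 (Matrix.specialUnitaryGroup (Fin 2) ℂ) → ℝ :=
    fun i => wilsonBoundaryAction rF.ρ (cubeEdges (fun k => x i k - (R + 1)) (2 * R + 3)) with hS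
  have hS0 : ∀ i U, 0 ≤ S i U := fun i U => wilsonBoundaryAction_nonneg rF _ U
  -- (1) pointwise: the exponent is at most `(β/12) Σ_i S_i`
  have hpt : ∀ U : LGConfig 4 (Matrix.specialUnitaryGroup (Fin 2) ℂ),
      Real.exp (∑ i ∈ T, carrierCl rF C 1 β R (q i) (x i) U) ≤ Real.exp (β / 12 * ∑ i ∈ T, S i U) := by
    intro U
    refine Real.exp_le_exp.2 ?_
    rw [mul_sum]
    refine sum_le_sum fun i _ => ?_
    refine (carrierCl_le_mul_wilsonBoundaryAction rF hCpos hβ0 R (q i) (hq i) (x i) U).trans ?_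
    have hcoef : β * (R : ℝ) ^ 4 / C ≤ β / 12 := by
      rw [div_le_div_iff₀ hCpos (by norm_num)]
      nlinarith
    exact mul_le_mul_of_nonneg_right hcoef (hS0 i U)
  -- continuity
  have hcA : Continuous fun U : LGConfig 4 (Matrix.specialUnitaryGroup (Fin 2) ℂ) =>
      Real.exp (∑ i ∈ T, carrierCl rF C 1 β R (q i) (x i) U) :=
    Real.continuous_exp.comp (continuous_finsetSum _ fun i _ =>
      continuous_const.mul (continuous_classicalResponse (r := rF) _ _ (q i) (x i) 1))
  have hcS : ∀ i, Continuous (S i) := fun i => continuous_wilsonBoundaryAction rF.ρ rF.continuous _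
  have hcB : Continuous fun U : LGConfig 4 (Matrix.specialUnitaryGroup (Fin 2) ℂ) => Real.exp (β / 12 * ∑ i ∈ T, S i U) :=
    Real.continuous_exp.comp (continuous_const.mul (continuous_finsetSum _ fun i _ => hcS i))
  refine (torusE_mono rF β L hcA hcB hpt).trans ?_
  -- (2) the right-hand side is the Wilson expectation of the exponential observable of ONE torus plaquette set
  set P : Finset (Plaquette 4 (2 * L + 1)) :=
    (T.sigma fun i => plaquettesTouching (cubeEdges (fun k => x i k - (R + 1)) (2 * R + 3))).image
      (fun ip : (Σ _ : Fin n, ZdPlaquette 4) => ((Torus.proj (2 * L + 1) ip.2.1, ip.2.2) : Plaquette 4 (2 * L + 1))) with hP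
  have hobs : ∀ U : GaugeConfig 4 (2 * L + 1) (Matrix.specialUnitaryGroup (Fin 2) ℂ),
      Real.exp (β / 12 * ∑ i ∈ T, S i (torusLift (2 * L + 1) U)) =
        expObs (G := Matrix.specialUnitaryGroup (Fin 2) ℂ) (fundamentalRep (Fin 2)) (β / 12) P U := by
    intro U
    unfold expObs
    congr 1
    rw [hP, ← sum_wilsonBoundaryAction_torusLift_eq (fundamentalRep (Fin 2)) hRL x hsep T U]
    rfl
  have hE : torusE (Matrix.specialUnitaryGroup (Fin 2) ℂ) rF β L (fun U => Real.exp (β / 12 * ∑ i ∈ T, S i U)) =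
      wilsonExpectation (fundamentalRep (Fin 2)) β (expObs (G := Matrix.specialUnitaryGroup (Fin 2) ℂ) (fundamentalRep (Fin 2)) (β / 12) P) := by
    unfold torusE wilsonExpectation
    exact integral_congr_ae (ae_of_all _ fun U => hobs U)
  rw [hE]
  -- (3) the β-uniform chessboard exponential moment
  haveI : NeZero (2 * L + 1) := ⟨by omega⟩
  have hodd : Odd (2 * L + 1) := ⟨L, rfl⟩
  have h3 : 3 ≤ 2 * L + 1 := by omega
  refine (su2_wilsonExpectation_expObs_le hodd h3 hβ (c := β / 12) (by positivity) le_rfl P).trans (Real.exp_le_exp.2 ?_)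
  have hK : 0 ≤ 81 + 6 * Real.log β / ((2 * L + 1 : ℕ) : ℝ) := by
    have : 0 ≤ Real.log β := Real.log_nonneg (by linarith)
    positivity
  have hcard : (#P : ℝ) ≤ 6 * (2 * R + 4) ^ 4 * #T := by
    have h := card_image_sigma_torusPlaq_le (L := L) (R := R) x T
    rw [← hP] at h
    exact_mod_cast h
  calc (#P : ℝ) * (81 + 6 * Real.log β / ((2 * L + 1 : ℕ) : ℝ))
      ≤ 6 * (2 * R + 4) ^ 4 * #T * (81 + 6 * Real.log β / ((2 * L + 1 : ℕ) : ℝ)) := mul_le_mul_of_nonneg_right hcard hK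
    _ = 6 * (2 * R + 4) ^ 4 * (81 + 6 * Real.log β / (2 * L + 1 : ℕ)) * #T := by ring

/-- **The rung in the doubled currency of the (RM) press** (`hEMQ` of `responseMoments_of_quadratic_and_influence`): for `C ≥ 24R⁴`,
`⟨exp(2·Σ_{i∈T} carrierCl C 1 β R (q i) (x i))⟩_{2L+1,β} ≤ exp(6(2R+4)⁴(81 + 6 log β/(2L+1))·#T)`. [folklore] -/
theorem torusE_exp_two_mul_sum_carrierCl_le_fixedScale {β : ℝ} (hβ : 2 ≤ β) {L n : ℕ} (q : Fin n → Fin 4 × Fin 4)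
    (x : Fin n → (Fin 4 → ℤ)) {R : ℕ} (hq : ∀ i, (q i).1 < (q i).2) (hR : 1 ≤ R) (hRL : 4 * R + 8 ≤ L)
    (hsep : ∀ i j : Fin n, i ≠ j → ∃ k : Fin 4,
      (2 * (R : ℤ) + 4) ≤ |((((x i k - x j k : ℤ) : ZMod (2 * L + 1))).valMinAbs : ℤ)|)
    {C : ℝ} (hC : 24 * (R : ℝ) ^ 4 ≤ C) (T : Finset (Fin n)) :
    torusE (Matrix.specialUnitaryGroup (Fin 2) ℂ) (fundamentalLatticeRep 2) β L
        (fun U => Real.exp (((2 : ℕ) : ℝ) * ∑ i ∈ T, carrierCl (fundamentalLatticeRep 2) C 1 β R (q i) (x i) U)) ≤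
      Real.exp (6 * (2 * R + 4) ^ 4 * (81 + 6 * Real.log β / (2 * L + 1 : ℕ)) * #T) := by
  have hR0 : (1 : ℝ) ≤ R := by exact_mod_cast hR
  have hR4 : (1 : ℝ) ≤ (R : ℝ) ^ 4 := one_le_pow₀ hR0
  have hCpos : 0 < C := lt_of_lt_of_le (by positivity) hC
  have e : (fun U => Real.exp (((2 : ℕ) : ℝ) * ∑ i ∈ T, carrierCl (fundamentalLatticeRep 2) C 1 β R (q i) (x i) U)) =
      (fun U => Real.exp (∑ i ∈ T, carrierCl (fundamentalLatticeRep 2) (C / 2) 1 β R (q i) (x i) U)) := by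
    funext U
    congr 1
    rw [mul_sum]
    refine sum_congr rfl fun i _ => ?_
    rw [carrierCl_eq_mul (fundamentalLatticeRep 2) C (C / 2) 1 β hCpos.ne',
      div_div_eq_mul_div, mul_comm C (2 : ℝ), mul_div_assoc, div_self hCpos.ne', mul_one]
    norm_num
  rw [e]
  exact torusE_exp_sum_carrierCl_le_fixedScale hβ q x hq hR hRL hsep (by linarith) T

/-- **On tori not smaller than `log β`** the constant is numerical: `C ≥ 12R⁴`, `log β ≤ 2L+1` ⇒
`⟨exp(Σ_{i∈T} carrierCl C 1 β R (q i) (x i))⟩_{2L+1,β} ≤ exp(522(2R+4)⁴·#T)`. [folklore] -/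
theorem torusE_exp_sum_carrierCl_le_fixedScale_of_log_le {β : ℝ} (hβ : 2 ≤ β) {L n : ℕ} (hlog : Real.log β ≤ (2 * L + 1 : ℕ))
    (q : Fin n → Fin 4 × Fin 4) (x : Fin n → (Fin 4 → ℤ)) {R : ℕ} (hq : ∀ i, (q i).1 < (q i).2) (hR : 1 ≤ R)
    (hRL : 4 * R + 8 ≤ L)
    (hsep : ∀ i j : Fin n, i ≠ j → ∃ k : Fin 4,
      (2 * (R : ℤ) + 4) ≤ |((((x i k - x j k : ℤ) : ZMod (2 * L + 1))).valMinAbs : ℤ)|)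
    {C : ℝ} (hC : 12 * (R : ℝ) ^ 4 ≤ C) (T : Finset (Fin n)) :
    torusE (Matrix.specialUnitaryGroup (Fin 2) ℂ) (fundamentalLatticeRep 2) β L
        (fun U => Real.exp (∑ i ∈ T, carrierCl (fundamentalLatticeRep 2) C 1 β R (q i) (x i) U)) ≤
      Real.exp (522 * (2 * R + 4) ^ 4 * #T) := by
  refine (torusE_exp_sum_carrierCl_le_fixedScale hβ q x hq hR hRL hsep hC T).trans (Real.exp_le_exp.2 ?_)
  have hM0 : (0 : ℝ) < ((2 * L + 1 : ℕ) : ℝ) := by positivity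
  have h1 : 6 * Real.log β / ((2 * L + 1 : ℕ) : ℝ) ≤ 6 := by
    rw [div_le_iff₀ hM0]; nlinarith
  have h2 : (0 : ℝ) ≤ 6 * (2 * R + 4) ^ 4 * #T := by positivity
  nlinarith

end Rung

/-! ### §2 The carrier MEAN at fixed scale (Jensen) -/

section Mean

variable {G : Type} [Group G] [TopologicalSpace G] [IsTopologicalGroup G] [CompactSpace G]
  [MeasurableSpace G] [BorelSpace G] (r : LatticeRep G)

/-- Jensen for `exp` under a probability measure: `exp(∫ f) ≤ ∫ exp f`. [folklore] -/
theorem exp_integral_le_integral_exp {Ω : Type*} [MeasurableSpace Ω] (μ : Measure Ω) [IsProbabilityMeasure μ] {f : Ω → ℝ}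
    (hfi : Integrable f μ) (hgi : Integrable (fun ω => Real.exp (f ω)) μ) :
    Real.exp (∫ ω, f ω ∂μ) ≤ ∫ ω, Real.exp (f ω) ∂μ :=
  convexOn_exp.map_integral_le Real.continuous_exp.continuousOn isClosed_univ
    (ae_of_all _ fun _ => Set.mem_univ _) hfi hgi

/-- Jensen for the torus state: `⟨A⟩_{2L+1,β} ≤ log ⟨exp A⟩_{2L+1,β}` for continuous `A`. [folklore] -/
theorem torusE_le_log_torusE_exp (β : ℝ) (L : ℕ) {A : LGConfig 4 G → ℝ} (hA : Continuous A) :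
    torusE G r β L A ≤ Real.log (torusE G r β L (fun U => Real.exp (A U))) := by
  haveI := r.secondCountableTopology
  haveI := isProbabilityMeasure_wilsonMeasure (d := 4) (L := 2 * L + 1) r.ρ r.continuous β
  have hfi : Integrable (fun U : GaugeConfig 4 (2 * L + 1) G => A (torusLift (2 * L + 1) U))
      (wilsonMeasure (d := 4) (L := 2 * L + 1) r.ρ β) := integrable_comp_lift r β L (F := A) hA
  have hgi : Integrable (fun U : GaugeConfig 4 (2 * L + 1) G => Real.exp (A (torusLift (2 * L + 1) U)))
      (wilsonMeasure (d := 4) (L := 2 * L + 1) r.ρ β) :=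
    integrable_comp_lift r β L (F := fun η => Real.exp (A η)) (Real.continuous_exp.comp hA)
  have hJ := exp_integral_le_integral_exp (wilsonMeasure (d := 4) (L := 2 * L + 1) r.ρ β) hfi hgi
  have h := Real.log_le_log (Real.exp_pos _) hJ
  rw [Real.log_exp] at h
  exact h

/-- **The carrier mean at fixed scale**: `SU(2)`, `β ≥ 2`, `1 ≤ R`, `4R+8 ≤ L`, `q.1 < q.2`:
`⟨carrierCl 1 1 β R q x⟩_{2L+1,β} ≤ 72R⁴(2R+4)⁴(81 + 6 log β/(2L+1))` (the one-member family of §4 at `C = 12R⁴`, Jensen, rescaling). [folklore] -/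
theorem torusE_carrierCl_le_fixedScale {β : ℝ} (hβ : 2 ≤ β) {L : ℕ} (q : Fin 4 × Fin 4) (hq : q.1 < q.2) (x : Fin 4 → ℤ)
    {R : ℕ} (hR : 1 ≤ R) (hRL : 4 * R + 8 ≤ L) :
    torusE (Matrix.specialUnitaryGroup (Fin 2) ℂ) (fundamentalLatticeRep 2) β L (carrierCl (fundamentalLatticeRep 2) 1 1 β R q x) ≤
      72 * (R : ℝ) ^ 4 * (2 * R + 4) ^ 4 * (81 + 6 * Real.log β / (2 * L + 1 : ℕ)) := by
  set rF : LatticeRep (Matrix.specialUnitaryGroup (Fin 2) ℂ) := fundamentalLatticeRep 2 with hrF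
  have hR0 : (1 : ℝ) ≤ R := by exact_mod_cast hR
  have hR4 : (1 : ℝ) ≤ (R : ℝ) ^ 4 := one_le_pow₀ hR0
  have h12 : (12 * (R : ℝ) ^ 4) ≠ 0 := by positivity
  -- the one-member family at `C = 12R⁴`
  have h1 := torusE_exp_sum_carrierCl_le_fixedScale hβ (n := 1) (fun _ => q) (fun _ => x) (fun _ => hq) hR hRL
    (fun i j hij => absurd (Subsingleton.elim i j) hij) (C := 12 * (R : ℝ) ^ 4) le_rfl Finset.univ
  simp only [univ_unique, sum_singleton, card_singleton, Nat.cast_one, mul_one] at h1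
  have hc : Continuous (carrierCl rF (12 * (R : ℝ) ^ 4) 1 β R q x) :=
    continuous_const.mul (continuous_classicalResponse (r := rF) _ _ q x 1)
  have hpos : 0 < torusE (Matrix.specialUnitaryGroup (Fin 2) ℂ) rF β L
      (fun U => Real.exp (carrierCl rF (12 * (R : ℝ) ^ 4) 1 β R q x U)) := by
    have hβ0 : 0 ≤ β := by linarith
    have h1le : torusE (Matrix.specialUnitaryGroup (Fin 2) ℂ) rF β L (fun _ => (1 : ℝ)) ≤
        torusE (Matrix.specialUnitaryGroup (Fin 2) ℂ) rF β L (fun U => Real.exp (carrierCl rF (12 * (R : ℝ) ^ 4) 1 β R q x U)) :=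
      torusE_mono rF β L continuous_const (Real.continuous_exp.comp hc) fun U =>
        Real.one_le_exp (carrierCl_nonneg (by positivity) one_pos hβ0 R q x U)
    rw [torusE_const] at h1le
    linarith
  have h2 : torusE (Matrix.specialUnitaryGroup (Fin 2) ℂ) rF β L (carrierCl rF (12 * (R : ℝ) ^ 4) 1 β R q x) ≤
      6 * (2 * R + 4) ^ 4 * (81 + 6 * Real.log β / (2 * L + 1 : ℕ)) := by
    refine (torusE_le_log_torusE_exp rF β L hc).trans ?_
    rw [Real.log_le_iff_le_exp hpos]
    exact h1
  have h3 : carrierCl rF 1 1 β R q x = fun U => 12 * (R : ℝ) ^ 4 * carrierCl rF (12 * (R : ℝ) ^ 4) 1 β R q x U := by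
    funext U
    rw [carrierCl_eq_mul rF (12 * (R : ℝ) ^ 4) 1 1 β h12, div_one]
  rw [h3, torusE_const_mul']
  have h4 := mul_le_mul_of_nonneg_left h2 (show (0 : ℝ) ≤ 12 * (R : ℝ) ^ 4 by positivity)
  refine h4.trans (le_of_eq ?_)
  ring

end Mean

end Summit.QuantumFields.YangMills.Cruxes.UVSeamRec.ClassicalResponse

end
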